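import Mathlib.LinearAlgebra.FreeModule.PID
import Mathlib.LinearAlgebra.Matrix.Rank
import Mathlib.LinearAlgebra.FiniteDimensional.Lemmas
import Mathlib.Algebra.Order.Floor.Ring
import Literature.NumberTheory.Sieve.LinearEquationsInPrimes
import HarnessLib

/-!
# Parametrisation of the affine lattice `{x ∈ ℤ^t : Ax = b}` (Green–Tao 2010, §4, derivation of Theorem 1.8) — module M1 of rung F-CS1-eq

Topic `Literature/NumberTheory/Sieve`. Source: B. Green, T. Tao, *Linear equations in primes*,
Ann. of Math. 171 (2010), 1753–1850 (arXiv:math/0606088), §4 "Linear algebra reductions", first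
paragraph of the derivation of Thm. 1.8 from the Main Theorem: "the set
`Γ := {x ∈ ℤ^t : Ax = b}` is a non-empty affine sublattice of `ℤ^t` of rank `d := t − s` … `Γ`
must contain at least one point of magnitude `O(N)` … the generators of this lattice can also be
chosen to have magnitude `O(1)` … Thus we have a multiplicity-free parameterisation
`Γ = Ψ(ℤ^{t−s})` for some system of affine-linear forms `Ψ` with `‖Ψ‖_N = O(1)`."

This file supplies that "standard linear algebra" as kernel theorems, for a FIXED integer matrix
`A` (uniformity over the finitely many `A` with entries bounded by `L` is then a finite maximum):

* `kerLattice A = ker A ∩ ℤ^t`, a saturated sublattice; `kerBasis A` a `ℤ`-basis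
  (`Submodule.basisOfPid`), `kerGen A j ∈ ℤ^t` its vectors, `kerDim A` their number;
* `kerDim_eq_sub_rank`: `kerDim A = t − rank_ℚ A` (the `ℤ`-basis is a `ℚ`-basis of `ker A_ℚ`:
  `linearIndependent_castVec_kerGen`, `span_castVec_kerGen_eq_ker`);
* `paramPoint A x₀ c = x₀ + ∑ⱼ cⱼ vⱼ` is a bijection `ℤ^{kerDim A} → {x : Ax = Ax₀}`
  (`paramPoint_injective`, `range_paramPoint`), packaged as the affine system
  `paramSystem A x₀ : Fin t → AffLinForm (kerDim A)` with `eval_paramSystem` and the size identity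
  `affLinSize_paramSystem`;
* `exists_basePoint_bound`: if `rank_ℚ A = s` (full row rank) there is `C = C(A)` such that every
  `b ∈ Aℤ^t` has a solution `x₀ ∈ ℤ^t`, `Ax₀ = b`, with `|x₀ᵢ| ≤ C (1 + ∑ₖ |bₖ|)` — Green–Tao's
  "point of magnitude `O(N)`" when `|b| ≤ LN` (floor reduction along the basis towards a rational
  solution).

## References

* [GreenTao2010] B. Green, T. Tao, *Linear equations in primes*, Ann. of Math. (2) 171 (2010),
  §4 (derivation of Thm. 1.8), Def. 1.1, (1.1).
-/

noncomputable section

open Finset Module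
open scoped Matrix

namespace Literature.NumberTheory.Sieve

variable {s t : ℕ}

/-! ### The integer kernel lattice and a `ℤ`-basis -/

/-- `Λ₀(A) = {x ∈ ℤ^t : Ax = 0}`. [cite: GreenTao2010, §4 (derivation of Thm. 1.8)] -/
def kerLattice (A : Matrix (Fin s) (Fin t) ℤ) : Submodule ℤ (Fin t → ℤ) :=
  LinearMap.ker A.mulVecLin

/-- Membership. [cite: GreenTao2010, §4 (derivation of Thm. 1.8)] -/
@[simp] theorem mem_kerLattice {A : Matrix (Fin s) (Fin t) ℤ} {x : Fin t → ℤ} :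
    x ∈ kerLattice A ↔ A *ᵥ x = 0 := by
  simp [kerLattice, LinearMap.mem_ker]

/-- `Λ₀(A)` is saturated: `m x ∈ Λ₀`, `m ≠ 0` implies `x ∈ Λ₀`.
[cite: GreenTao2010, §4 (derivation of Thm. 1.8)] -/
theorem mem_kerLattice_of_smul_mem {A : Matrix (Fin s) (Fin t) ℤ} {m : ℤ} (hm : m ≠ 0)
    {x : Fin t → ℤ} (h : m • x ∈ kerLattice A) : x ∈ kerLattice A := by
  rw [mem_kerLattice] at h ⊢
  rw [Matrix.mulVec_smul] at h
  exact (smul_eq_zero.mp h).resolve_left hm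

/-- The rank `t − s` of the kernel lattice (as the length of a `ℤ`-basis).
[cite: GreenTao2010, §4 (derivation of Thm. 1.8)] -/
def kerDim (A : Matrix (Fin s) (Fin t) ℤ) : ℕ :=
  (Submodule.basisOfPid (Pi.basisFun ℤ (Fin t)) (kerLattice A)).1

/-- A `ℤ`-basis of the kernel lattice (structure theorem over a PID).
[cite: GreenTao2010, §4 (derivation of Thm. 1.8)] -/
def kerBasis (A : Matrix (Fin s) (Fin t) ℤ) : Basis (Fin (kerDim A)) ℤ (kerLattice A) :=
  (Submodule.basisOfPid (Pi.basisFun ℤ (Fin t)) (kerLattice A)).2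

/-- The generators `v₁, …, v_{t−s} ∈ ℤ^t` of the kernel lattice.
[cite: GreenTao2010, §4 (derivation of Thm. 1.8)] -/
def kerGen (A : Matrix (Fin s) (Fin t) ℤ) (j : Fin (kerDim A)) : Fin t → ℤ :=
  ((kerBasis A j : kerLattice A) : Fin t → ℤ)

/-- Generators lie in the lattice. [cite: GreenTao2010, §4 (derivation of Thm. 1.8)] -/
theorem kerGen_mem (A : Matrix (Fin s) (Fin t) ℤ) (j : Fin (kerDim A)) : kerGen A j ∈ kerLattice A :=
  (kerBasis A j).2

/-- `A vⱼ = 0`. [cite: GreenTao2010, §4 (derivation of Thm. 1.8)] -/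
@[simp] theorem mulVec_kerGen (A : Matrix (Fin s) (Fin t) ℤ) (j : Fin (kerDim A)) :
    A *ᵥ kerGen A j = 0 :=
  mem_kerLattice.mp (kerGen_mem A j)

/-- The generators are `ℤ`-linearly independent. [cite: GreenTao2010, §4 (derivation of Thm. 1.8)] -/
theorem linearIndependent_kerGen (A : Matrix (Fin s) (Fin t) ℤ) : LinearIndependent ℤ (kerGen A) :=
  (kerBasis A).linearIndependent.map' (kerLattice A).subtype (Submodule.ker_subtype _)

/-- The generators span the kernel lattice. [cite: GreenTao2010, §4 (derivation of Thm. 1.8)] -/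
theorem span_kerGen (A : Matrix (Fin s) (Fin t) ℤ) :
    Submodule.span ℤ (Set.range (kerGen A)) = kerLattice A := by
  have hr : Set.range (kerGen A) = (kerLattice A).subtype '' Set.range (kerBasis A) := by
    ext x
    simp only [Set.mem_range, Set.mem_image, exists_exists_eq_and, Submodule.coe_subtype]
    rfl
  rw [hr, Submodule.span_image, (kerBasis A).span_eq, Submodule.map_top, Submodule.range_subtype]

/-- Coordinates: every lattice vector is an integer combination of the generators.
[cite: GreenTao2010, §4 (derivation of Thm. 1.8)] -/
theorem exists_sum_smul_kerGen_eq {A : Matrix (Fin s) (Fin t) ℤ} {x : Fin t → ℤ}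
    (hx : x ∈ kerLattice A) : ∃ c : Fin (kerDim A) → ℤ, ∑ j, c j • kerGen A j = x := by
  rw [← span_kerGen] at hx
  exact Submodule.mem_span_range_iff_exists_fun ℤ |>.mp hx

/-! ### The parametrisation `c ↦ x₀ + ∑ⱼ cⱼ vⱼ` -/

/-- `Ψ(c) = x₀ + ∑ⱼ cⱼ vⱼ ∈ ℤ^t`. [cite: GreenTao2010, §4 (derivation of Thm. 1.8)] -/
def paramPoint (A : Matrix (Fin s) (Fin t) ℤ) (x₀ : Fin t → ℤ) (c : Fin (kerDim A) → ℤ) :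
    Fin t → ℤ :=
  x₀ + ∑ j, c j • kerGen A j

/-- `A Ψ(c) = A x₀`. [cite: GreenTao2010, §4 (derivation of Thm. 1.8)] -/
theorem mulVec_paramPoint (A : Matrix (Fin s) (Fin t) ℤ) (x₀ : Fin t → ℤ) (c : Fin (kerDim A) → ℤ) :
    A *ᵥ paramPoint A x₀ c = A *ᵥ x₀ := by
  have h : A *ᵥ (∑ j, c j • kerGen A j) = 0 := by
    rw [← Matrix.mulVecLin_apply, map_sum]
    refine Finset.sum_eq_zero fun j _ => ?_
    rw [map_smul, Matrix.mulVecLin_apply, mulVec_kerGen, smul_zero]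
  show A *ᵥ (x₀ + ∑ j, c j • kerGen A j) = A *ᵥ x₀
  rw [Matrix.mulVec_add, h, add_zero]

/-- The parametrisation is injective ("multiplicity-free").
[cite: GreenTao2010, §4 (derivation of Thm. 1.8)] -/
theorem paramPoint_injective (A : Matrix (Fin s) (Fin t) ℤ) (x₀ : Fin t → ℤ) :
    Function.Injective (paramPoint A x₀) := by
  intro c c' h
  have h1 : ∑ j, c j • kerGen A j = ∑ j, c' j • kerGen A j := by
    unfold paramPoint at h
    exact add_left_cancel h
  have h' : ∑ j, (c j - c' j) • kerGen A j = 0 := by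
    simp only [sub_smul, Finset.sum_sub_distrib, h1, sub_self]
  have := Fintype.linearIndependent_iff.mp (linearIndependent_kerGen A) (fun j => c j - c' j) h'
  funext j
  exact sub_eq_zero.mp (this j)

/-- The parametrisation is onto `{x : Ax = Ax₀}`. [cite: GreenTao2010, §4 (derivation of Thm. 1.8)] -/
theorem exists_paramPoint_eq {A : Matrix (Fin s) (Fin t) ℤ} {x₀ x : Fin t → ℤ}
    (hx : A *ᵥ x = A *ᵥ x₀) : ∃ c : Fin (kerDim A) → ℤ, paramPoint A x₀ c = x := by
  have hmem : x - x₀ ∈ kerLattice A := by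
    rw [mem_kerLattice, Matrix.mulVec_sub, hx, sub_self]
  obtain ⟨c, hc⟩ := exists_sum_smul_kerGen_eq hmem
  refine ⟨c, ?_⟩
  show x₀ + ∑ j, c j • kerGen A j = x
  rw [hc]
  abel

/-- `Γ = {x ∈ ℤ^t : Ax = b} = Ψ(ℤ^{t−s})` for any `x₀ ∈ Γ`.
[cite: GreenTao2010, §4 (derivation of Thm. 1.8)] -/
theorem range_paramPoint {A : Matrix (Fin s) (Fin t) ℤ} {x₀ : Fin t → ℤ} {b : Fin s → ℤ}
    (hx₀ : A *ᵥ x₀ = b) : Set.range (paramPoint A x₀) = {x | A *ᵥ x = b} := by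
  ext x
  constructor
  · rintro ⟨c, rfl⟩
    rw [Set.mem_setOf_eq, mulVec_paramPoint, hx₀]
  · intro hx
    exact exists_paramPoint_eq (by rw [Set.mem_setOf_eq] at hx; rw [hx, hx₀])

/-! ### Comparison with the rational kernel: `kerDim A = t − rank_ℚ A` -/

/-- The matrix over `ℚ`. [cite: GreenTao2010, §4 (derivation of Thm. 1.8)] -/
def ratMat (A : Matrix (Fin s) (Fin t) ℤ) : Matrix (Fin s) (Fin t) ℚ := A.map (Int.castRingHom ℚ)

/-- A lattice point as a rational vector. [cite: GreenTao2010, §4 (derivation of Thm. 1.8)] -/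
def castVec {n : ℕ} (x : Fin n → ℤ) : Fin n → ℚ := fun i => (x i : ℚ)

/-- [cite: GreenTao2010, §4 (derivation of Thm. 1.8)] -/
@[simp] theorem castVec_apply {n : ℕ} (x : Fin n → ℤ) (i : Fin n) : castVec x i = (x i : ℚ) := rfl

/-- [cite: GreenTao2010, §4 (derivation of Thm. 1.8)] -/
theorem castVec_injective {n : ℕ} : Function.Injective (castVec (n := n)) := fun x y h =>
  funext fun i => by
    have h' := congr_fun h i
    simp only [castVec_apply, Int.cast_inj] at h'
    exact h'

/-- [cite: GreenTao2010, §4 (derivation of Thm. 1.8)] -/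
@[simp] theorem castVec_zero {n : ℕ} : castVec (0 : Fin n → ℤ) = 0 := by
  funext i; simp

/-- [cite: GreenTao2010, §4 (derivation of Thm. 1.8)] -/
@[simp] theorem castVec_add {n : ℕ} (x y : Fin n → ℤ) : castVec (x + y) = castVec x + castVec y := by
  funext i; simp

/-- [cite: GreenTao2010, §4 (derivation of Thm. 1.8)] -/
@[simp] theorem castVec_sub {n : ℕ} (x y : Fin n → ℤ) : castVec (x - y) = castVec x - castVec y := by
  funext i; simp

/-- [cite: GreenTao2010, §4 (derivation of Thm. 1.8)] -/
@[simp] theorem castVec_smul {n : ℕ} (m : ℤ) (x : Fin n → ℤ) : castVec (m • x) = (m : ℚ) • castVec x := by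
  funext i; simp

/-- [cite: GreenTao2010, §4 (derivation of Thm. 1.8)] -/
theorem castVec_sum {n : ℕ} {ι : Type*} (S : Finset ι) (f : ι → Fin n → ℤ) :
    castVec (∑ k ∈ S, f k) = ∑ k ∈ S, castVec (f k) := by
  funext i; simp [Finset.sum_apply]

/-- `A_ℚ x = (Ax)` for integer `x`. [cite: GreenTao2010, §4 (derivation of Thm. 1.8)] -/
theorem ratMat_mulVec_castVec (A : Matrix (Fin s) (Fin t) ℤ) (x : Fin t → ℤ) :
    ratMat A *ᵥ castVec x = castVec (A *ᵥ x) := by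
  funext i
  have h := RingHom.map_mulVec (Int.castRingHom ℚ) A x i
  have hc : (⇑(Int.castRingHom ℚ) ∘ x) = castVec x := funext fun j => by simp
  rw [hc] at h
  rw [ratMat, ← h]
  simp

/-- The integer generators are `ℚ`-linearly independent (clear denominators).
[cite: GreenTao2010, §4 (derivation of Thm. 1.8)] -/
theorem linearIndependent_castVec_kerGen (A : Matrix (Fin s) (Fin t) ℤ) :
    LinearIndependent ℚ (fun j => castVec (kerGen A j)) := by
  rw [Fintype.linearIndependent_iff]
  intro g hg
  -- a common denominator
  set D : ℤ := ∏ j, ((g j).den : ℤ) with hD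
  have hD0 : D ≠ 0 := Finset.prod_ne_zero_iff.mpr fun j _ => by exact_mod_cast (g j).den_nz
  have hint : ∀ j, ∃ m : ℤ, (m : ℚ) = D * g j := by
    intro j
    refine ⟨(g j).num * ∏ k ∈ univ.erase j, ((g k).den : ℤ), ?_⟩
    rw [hD, ← Finset.mul_prod_erase univ (fun k => ((g k).den : ℤ)) (mem_univ j)]
    push_cast
    have hq : ((g j).den : ℚ) * g j = (g j).num := by
      have := Rat.num_div_den (g j)
      rw [div_eq_iff (by exact_mod_cast (g j).den_nz)] at this
      rw [mul_comm]; exact this.symm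
    calc ((g j).num : ℚ) * ∏ k ∈ univ.erase j, ((g k).den : ℚ)
        = ((g j).den * g j) * ∏ k ∈ univ.erase j, ((g k).den : ℚ) := by rw [hq]
      _ = ((g j).den : ℚ) * (∏ k ∈ univ.erase j, ((g k).den : ℚ)) * g j := by ring
  choose m hm using hint
  have h0 : ∑ j, m j • kerGen A j = 0 := by
    apply castVec_injective
    rw [castVec_sum, castVec_zero]
    simp only [castVec_smul, hm, mul_smul]
    rw [← Finset.smul_sum, hg, smul_zero]
  have hli := Fintype.linearIndependent_iff.mp (linearIndependent_kerGen A) m h0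
  intro j
  have : (D : ℚ) * g j = 0 := by rw [← hm j, hli j]; simp
  exact (mul_eq_zero.mp this).resolve_left (by exact_mod_cast hD0)

/-- Every rational kernel vector is a rational combination of the integer generators
(clear denominators, then use the `ℤ`-basis). [cite: GreenTao2010, §4 (derivation of Thm. 1.8)] -/
theorem mem_span_castVec_kerGen {A : Matrix (Fin s) (Fin t) ℤ} {w : Fin t → ℚ}
    (hw : ratMat A *ᵥ w = 0) :
    w ∈ Submodule.span ℚ (Set.range fun j => castVec (kerGen A j)) := by
  set D : ℤ := ∏ i, ((w i).den : ℤ) with hD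
  have hD0 : D ≠ 0 := Finset.prod_ne_zero_iff.mpr fun i _ => by exact_mod_cast (w i).den_nz
  have hint : ∀ i, ∃ m : ℤ, (m : ℚ) = D * w i := by
    intro i
    refine ⟨(w i).num * ∏ k ∈ univ.erase i, ((w k).den : ℤ), ?_⟩
    rw [hD, ← Finset.mul_prod_erase univ (fun k => ((w k).den : ℤ)) (mem_univ i)]
    push_cast
    have hq : ((w i).den : ℚ) * w i = (w i).num := by
      have := Rat.num_div_den (w i)
      rw [div_eq_iff (by exact_mod_cast (w i).den_nz)] at this
      rw [mul_comm]; exact this.symm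
    calc ((w i).num : ℚ) * ∏ k ∈ univ.erase i, ((w k).den : ℚ)
        = ((w i).den * w i) * ∏ k ∈ univ.erase i, ((w k).den : ℚ) := by rw [hq]
      _ = ((w i).den : ℚ) * (∏ k ∈ univ.erase i, ((w k).den : ℚ)) * w i := by ring
  choose x hx using hint
  -- `x = D w` is an integer kernel vector
  have hxw : castVec x = (D : ℚ) • w := funext fun i => by simp [hx i]
  have hxker : x ∈ kerLattice A := by
    rw [mem_kerLattice]
    apply castVec_injective
    rw [← ratMat_mulVec_castVec, hxw, Matrix.mulVec_smul, hw, smul_zero, castVec_zero]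
  obtain ⟨c, hc⟩ := exists_sum_smul_kerGen_eq hxker
  have hw' : w = ∑ j, ((c j : ℚ) / D) • castVec (kerGen A j) := by
    have hD0' : (D : ℚ) ≠ 0 := by exact_mod_cast hD0
    have : (D : ℚ) • w = ∑ j, (c j : ℚ) • castVec (kerGen A j) := by
      rw [← hxw, ← hc, castVec_sum]
      exact Finset.sum_congr rfl fun j _ => castVec_smul _ _
    calc w = (D : ℚ)⁻¹ • ((D : ℚ) • w) := by rw [smul_smul, inv_mul_cancel₀ hD0', one_smul]
      _ = ∑ j, ((c j : ℚ) / D) • castVec (kerGen A j) := by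
          rw [this, Finset.smul_sum]
          refine Finset.sum_congr rfl fun j _ => ?_
          rw [smul_smul, div_eq_inv_mul]
  rw [hw']
  exact Submodule.sum_mem _ fun j _ => Submodule.smul_mem _ _ (Submodule.subset_span ⟨j, rfl⟩)

/-- The `ℤ`-basis of `Λ₀(A)` spans exactly `ker A_ℚ`. [cite: GreenTao2010, §4 (derivation of Thm. 1.8)] -/
theorem span_castVec_kerGen_eq_ker (A : Matrix (Fin s) (Fin t) ℤ) :
    Submodule.span ℚ (Set.range fun j => castVec (kerGen A j)) = LinearMap.ker (ratMat A).mulVecLin := by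
  apply le_antisymm
  · rw [Submodule.span_le]
    rintro _ ⟨j, rfl⟩
    rw [SetLike.mem_coe, LinearMap.mem_ker, Matrix.mulVecLin_apply, ratMat_mulVec_castVec,
      mulVec_kerGen, castVec_zero]
  · intro w hw
    exact mem_span_castVec_kerGen (by simpa [Matrix.mulVecLin_apply] using hw)

/-- **Rank of the kernel lattice**: `kerDim A = t − rank_ℚ(A)`.
[cite: GreenTao2010, §4 (derivation of Thm. 1.8)] -/
theorem kerDim_eq_sub_rank (A : Matrix (Fin s) (Fin t) ℤ) : kerDim A = t - (ratMat A).rank := by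
  have h1 : finrank ℚ (LinearMap.ker (ratMat A).mulVecLin) = kerDim A := by
    rw [← span_castVec_kerGen_eq_ker, finrank_span_eq_card (linearIndependent_castVec_kerGen A),
      Fintype.card_fin]
  have h2 := LinearMap.finrank_range_add_finrank_ker (ratMat A).mulVecLin
  rw [Module.finrank_fin_fun, h1] at h2
  unfold Matrix.rank
  omega

/-- With full row rank `s` the kernel lattice has rank `t − s` ("rank `d := t − s`").
[cite: GreenTao2010, §4 (derivation of Thm. 1.8)] -/
theorem kerDim_eq_of_rank_eq {A : Matrix (Fin s) (Fin t) ℤ} (hA : (ratMat A).rank = s) :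
    kerDim A = t - s := by
  rw [kerDim_eq_sub_rank, hA]

/-! ### A base point of controlled size (full row rank) -/

/-- Full row rank: `A_ℚ : ℚ^t → ℚ^s` is onto. [cite: GreenTao2010, §4 (derivation of Thm. 1.8)] -/
theorem range_ratMat_eq_top {A : Matrix (Fin s) (Fin t) ℤ} (hA : (ratMat A).rank = s) :
    LinearMap.range (ratMat A).mulVecLin = ⊤ := by
  apply Submodule.eq_top_of_finrank_eq
  rw [Module.finrank_fin_fun]
  exact hA

/-- Rational solutions of `A_ℚ r = e_k`. [cite: GreenTao2010, §4 (derivation of Thm. 1.8)] -/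
theorem exists_ratSol {A : Matrix (Fin s) (Fin t) ℤ} (hA : (ratMat A).rank = s) (k : Fin s) :
    ∃ r : Fin t → ℚ, ratMat A *ᵥ r = Pi.single k 1 := by
  have h : (Pi.single k 1 : Fin s → ℚ) ∈ LinearMap.range (ratMat A).mulVecLin := by
    rw [range_ratMat_eq_top hA]; trivial
  obtain ⟨r, hr⟩ := LinearMap.mem_range.mp h
  exact ⟨r, by rwa [Matrix.mulVecLin_apply] at hr⟩

/-- **A lattice point of `Γ_b` of magnitude `O_A(1 + |b|)`** (Green–Tao: "`Γ` must contain at least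
one point of magnitude `O(N)`"): floor reduction along the `ℤ`-basis of `Λ₀(A)` towards a rational
solution. [cite: GreenTao2010, §4 (derivation of Thm. 1.8)] -/
theorem exists_basePoint_bound {A : Matrix (Fin s) (Fin t) ℤ} (hA : (ratMat A).rank = s) :
    ∃ C : ℝ, 0 ≤ C ∧ ∀ b : Fin s → ℤ, (∃ y : Fin t → ℤ, A *ᵥ y = b) →
      ∃ x₀ : Fin t → ℤ, A *ᵥ x₀ = b ∧ ∀ i, |(x₀ i : ℝ)| ≤ C * (1 + ∑ k, |(b k : ℝ)|) := by
  classical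
  choose r hr using exists_ratSol hA
  set R : ℚ := ∑ k, ∑ i, |r k i| with hRdef
  set V : ℚ := ∑ j, ∑ i, |(kerGen A j i : ℚ)| with hVdef
  have hR0 : 0 ≤ R := Finset.sum_nonneg fun _ _ => Finset.sum_nonneg fun _ _ => abs_nonneg _
  have hV0 : 0 ≤ V := Finset.sum_nonneg fun _ _ => Finset.sum_nonneg fun _ _ => abs_nonneg _
  refine ⟨((max R V : ℚ) : ℝ), by exact_mod_cast le_max_of_le_left hR0, fun b hb => ?_⟩
  obtain ⟨y, hy⟩ := hb
  -- the rational solution `x* = ∑ₖ bₖ rₖ`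
  set xs : Fin t → ℚ := fun i => ∑ k, (b k : ℚ) * r k i with hxsdef
  have hxs' : xs = ∑ k, (b k : ℚ) • r k := by
    funext i; simp [hxsdef, Finset.sum_apply]
  have hAxs : ratMat A *ᵥ xs = castVec b := by
    rw [hxs', ← Matrix.mulVecLin_apply, map_sum]
    funext i
    simp only [map_smul, Matrix.mulVecLin_apply, hr, Finset.sum_apply, Pi.smul_apply,
      Pi.single_apply, smul_eq_mul, mul_ite, mul_one, mul_zero, Finset.sum_ite_eq,
      Finset.mem_univ, if_true, castVec_apply]
  -- `y - x*` is a rational kernel vector, hence a rational combination of the generators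
  have hw : ratMat A *ᵥ (castVec y - xs) = 0 := by
    rw [Matrix.mulVec_sub, ratMat_mulVec_castVec, hy, hAxs, sub_self]
  obtain ⟨c, hc⟩ :=
    (Submodule.mem_span_range_iff_exists_fun ℚ).mp (mem_span_castVec_kerGen hw)
  have hAz : A *ᵥ (∑ j, ⌊c j⌋ • kerGen A j) = 0 := by
    rw [← Matrix.mulVecLin_apply, map_sum]
    refine Finset.sum_eq_zero fun j _ => ?_
    rw [map_smul, Matrix.mulVecLin_apply, mulVec_kerGen, smul_zero]
  refine ⟨y - ∑ j, ⌊c j⌋ • kerGen A j, ?_, fun i => ?_⟩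
  · rw [Matrix.mulVec_sub, hy, hAz, sub_zero]
  · have hcast : castVec (y - ∑ j, ⌊c j⌋ • kerGen A j) =
        xs + ∑ j, (c j - ⌊c j⌋) • castVec (kerGen A j) := by
      have hy' : castVec y = xs + ∑ j, c j • castVec (kerGen A j) := by
        rw [hc]; abel
      rw [castVec_sub, castVec_sum, hy']
      have : ∑ j, castVec (⌊c j⌋ • kerGen A j) = ∑ j, (⌊c j⌋ : ℚ) • castVec (kerGen A j) :=
        Finset.sum_congr rfl fun j _ => castVec_smul _ _
      rw [this]
      simp only [sub_smul, Finset.sum_sub_distrib]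
      abel
    have hq : |(((y - ∑ j, ⌊c j⌋ • kerGen A j) i : ℤ) : ℚ)| ≤ max R V * (1 + ∑ k, |(b k : ℚ)|) := by
      have hi := congr_fun hcast i
      rw [castVec_apply] at hi
      rw [hi]
      simp only [Pi.add_apply, Finset.sum_apply, Pi.smul_apply, smul_eq_mul]
      have hsb : 0 ≤ ∑ k, |(b k : ℚ)| := Finset.sum_nonneg fun _ _ => abs_nonneg _
      have h1 : |xs i| ≤ R * ∑ k, |(b k : ℚ)| := by
        calc |xs i| = |∑ k, (b k : ℚ) * r k i| := rfl
          _ ≤ ∑ k, |(b k : ℚ) * r k i| := Finset.abs_sum_le_sum_abs _ _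
          _ ≤ ∑ k, |(b k : ℚ)| * R := by
              refine Finset.sum_le_sum fun k _ => ?_
              rw [abs_mul]
              refine mul_le_mul_of_nonneg_left ?_ (abs_nonneg _)
              calc |r k i| ≤ ∑ i', |r k i'| :=
                    Finset.single_le_sum (f := fun i' => |r k i'|) (fun _ _ => abs_nonneg _)
                      (Finset.mem_univ i)
                _ ≤ R := Finset.single_le_sum (f := fun k' => ∑ i', |r k' i'|)
                      (fun _ _ => Finset.sum_nonneg fun _ _ => abs_nonneg _) (Finset.mem_univ k)
          _ = R * ∑ k, |(b k : ℚ)| := by rw [← Finset.sum_mul, mul_comm]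
      have h2 : ∑ j, |(c j - ⌊c j⌋) * (kerGen A j i : ℚ)| ≤ V := by
        calc ∑ j, |(c j - ⌊c j⌋) * (kerGen A j i : ℚ)| ≤ ∑ j, |(kerGen A j i : ℚ)| := by
              refine Finset.sum_le_sum fun j _ => ?_
              rw [abs_mul, Int.self_sub_floor, abs_of_nonneg (Int.fract_nonneg _)]
              exact mul_le_of_le_one_left (abs_nonneg _) (Int.fract_lt_one _).le
          _ ≤ V := Finset.sum_le_sum fun j _ =>
              Finset.single_le_sum (f := fun i' => |(kerGen A j i' : ℚ)|) (fun _ _ => abs_nonneg _)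
                (Finset.mem_univ i)
      calc |xs i + ∑ j, (c j - ⌊c j⌋) * (kerGen A j i : ℚ)|
          ≤ |xs i| + |∑ j, (c j - ⌊c j⌋) * (kerGen A j i : ℚ)| := abs_add_le _ _
        _ ≤ |xs i| + ∑ j, |(c j - ⌊c j⌋) * (kerGen A j i : ℚ)| :=
            add_le_add le_rfl (Finset.abs_sum_le_sum_abs _ _)
        _ ≤ R * ∑ k, |(b k : ℚ)| + V := add_le_add h1 h2
        _ ≤ max R V * ∑ k, |(b k : ℚ)| + max R V :=
            add_le_add (mul_le_mul_of_nonneg_right (le_max_left _ _) hsb) (le_max_right _ _)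
        _ = max R V * (1 + ∑ k, |(b k : ℚ)|) := by ring
    have hq' := (Rat.cast_le (K := ℝ)).mpr hq
    push_cast at hq' ⊢
    exact hq'

/-! ### Packaging as a system of affine-linear forms (Def. 1.1) -/

/-- The parametrising system `Ψ = (ψ₁, …, ψ_t) : ℤ^{kerDim A} → ℤ^t`,
`ψᵢ(c) = (x₀)ᵢ + ∑ⱼ (vⱼ)ᵢ cⱼ`. [cite: GreenTao2010, §4 (derivation of Thm. 1.8) and Def. 1.1] -/
def paramSystem (A : Matrix (Fin s) (Fin t) ℤ) (x₀ : Fin t → ℤ) : Fin t → AffLinForm (kerDim A) :=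
  fun i => ⟨fun j => kerGen A j i, x₀ i⟩

/-- [cite: GreenTao2010, §4 (derivation of Thm. 1.8)] -/
@[simp] theorem paramSystem_coeff (A : Matrix (Fin s) (Fin t) ℤ) (x₀ : Fin t → ℤ) (i : Fin t)
    (j : Fin (kerDim A)) : (paramSystem A x₀ i).coeff j = kerGen A j i := rfl

/-- [cite: GreenTao2010, §4 (derivation of Thm. 1.8)] -/
@[simp] theorem paramSystem_const (A : Matrix (Fin s) (Fin t) ℤ) (x₀ : Fin t → ℤ) (i : Fin t) :
    (paramSystem A x₀ i).const = x₀ i := rfl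

/-- `ψᵢ(c) = Ψ(c)ᵢ`: the system evaluates to the parametrisation.
[cite: GreenTao2010, §4 (derivation of Thm. 1.8) and Def. 1.1] -/
theorem eval_paramSystem (A : Matrix (Fin s) (Fin t) ℤ) (x₀ : Fin t → ℤ) (c : Fin (kerDim A) → ℤ)
    (i : Fin t) : (paramSystem A x₀ i).eval c = paramPoint A x₀ c i := by
  simp only [paramSystem, AffLinForm.eval, paramPoint, Pi.add_apply, Finset.sum_apply,
    Pi.smul_apply, smul_eq_mul]
  rw [add_comm]
  exact congrArg _ (Finset.sum_congr rfl fun j _ => mul_comm _ _)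

/-- The lattice points `c` with `Ψ(c) = x`, for `x ∈ Γ`, form exactly one point
(multiplicity-free parametrisation, as a statement about `eval`).
[cite: GreenTao2010, §4 (derivation of Thm. 1.8)] -/
theorem existsUnique_eval_paramSystem_eq {A : Matrix (Fin s) (Fin t) ℤ} {x₀ x : Fin t → ℤ}
    (hx : A *ᵥ x = A *ᵥ x₀) : ∃! c : Fin (kerDim A) → ℤ, ∀ i, (paramSystem A x₀ i).eval c = x i := by
  obtain ⟨c, hc⟩ := exists_paramPoint_eq hx
  refine ⟨c, fun i => by rw [eval_paramSystem, hc], fun c' hc' => paramPoint_injective A x₀ ?_⟩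
  rw [hc]
  funext i
  rw [← eval_paramSystem, hc' i]

/-- The size `‖Ψ‖_N` of the parametrising system ((1.1)): generators part plus `|x₀|/N` part.
[cite: GreenTao2010, (1.1) and §4 (derivation of Thm. 1.8)] -/
theorem affLinSize_paramSystem (A : Matrix (Fin s) (Fin t) ℤ) (x₀ : Fin t → ℤ) (N : ℝ) :
    affLinSize (paramSystem A x₀) N =
      (∑ i, ∑ j, |(kerGen A j i : ℝ)|) + ∑ i, |(x₀ i : ℝ) / N| := rfl

/-- `‖Ψ‖_N ≤ V(A) + t·B/N` when `|x₀ᵢ| ≤ B` — with `B = C(1 + |b|) = O(N)` from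
`exists_basePoint_bound` this is Green–Tao's `‖Ψ‖_N = O(1)`.
[cite: GreenTao2010, (1.1) and §4 (derivation of Thm. 1.8)] -/
theorem affLinSize_paramSystem_le (A : Matrix (Fin s) (Fin t) ℤ) {x₀ : Fin t → ℤ} {B N : ℝ}
    (hN : 0 < N) (hB : ∀ i, |(x₀ i : ℝ)| ≤ B) :
    affLinSize (paramSystem A x₀) N ≤ (∑ i, ∑ j, |(kerGen A j i : ℝ)|) + t * B / N := by
  rw [affLinSize_paramSystem]
  refine add_le_add le_rfl ?_
  calc ∑ i, |(x₀ i : ℝ) / N| ≤ ∑ _i : Fin t, B / N := by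
        refine Finset.sum_le_sum fun i _ => ?_
        rw [abs_div, abs_of_pos hN]
        exact div_le_div_of_nonneg_right (hB i) hN.le
    _ = t * B / N := by
        rw [Finset.sum_const, Finset.card_univ, Fintype.card_fin, nsmul_eq_mul]
        ring

/-- **Green–Tao 2010, §4 ¶1 (the affine lattice parametrisation), assembled**: for an integer
`s × t` matrix of full row rank `s` there is `C = C(A) ≥ 0` such that for every `b ∈ Aℤ^t` the
affine lattice `Γ_b = {x ∈ ℤ^t : Ax = b}` is `Ψ(ℤ^{t−s})`, injectively, for the system
`Ψ = paramSystem A x₀` in `kerDim A = t − s` variables whose size satisfies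
`‖Ψ‖_N ≤ C + t·C(1 + ∑ₖ|bₖ|)/N` for all `N > 0`.
[cite: GreenTao2010, §4 (derivation of Thm. 1.8)] -/
theorem exists_affineLatticeParam {A : Matrix (Fin s) (Fin t) ℤ} (hA : (ratMat A).rank = s) :
    ∃ C : ℝ, 0 ≤ C ∧ ∀ b : Fin s → ℤ, (∃ y : Fin t → ℤ, A *ᵥ y = b) →
      ∃ x₀ : Fin t → ℤ, A *ᵥ x₀ = b ∧
        Set.range (paramPoint A x₀) = {x | A *ᵥ x = b} ∧ Function.Injective (paramPoint A x₀) ∧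
        kerDim A = t - s ∧
        ∀ N : ℝ, 0 < N →
          affLinSize (paramSystem A x₀) N ≤ C + t * (C * (1 + ∑ k, |(b k : ℝ)|)) / N := by
  obtain ⟨C₀, hC₀, hbase⟩ := exists_basePoint_bound hA
  set V : ℝ := ∑ i, ∑ j, |(kerGen A j i : ℝ)| with hV
  have hV0 : 0 ≤ V := Finset.sum_nonneg fun _ _ => Finset.sum_nonneg fun _ _ => abs_nonneg _
  refine ⟨max C₀ V, le_max_of_le_left hC₀, fun b hb => ?_⟩
  obtain ⟨x₀, hx₀, hbd⟩ := hbase b hb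
  refine ⟨x₀, hx₀, range_paramPoint hx₀, paramPoint_injective A x₀, kerDim_eq_of_rank_eq hA,
    fun N hN => ?_⟩
  have hsb : 0 ≤ 1 + ∑ k, |(b k : ℝ)| := add_nonneg zero_le_one (Finset.sum_nonneg fun _ _ => abs_nonneg _)
  calc affLinSize (paramSystem A x₀) N ≤ V + t * (C₀ * (1 + ∑ k, |(b k : ℝ)|)) / N :=
        affLinSize_paramSystem_le A hN hbd
    _ ≤ max C₀ V + t * (max C₀ V * (1 + ∑ k, |(b k : ℝ)|)) / N := by
        gcongr
        · exact le_max_right _ _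
        · exact le_max_left _ _

end Literature.NumberTheory.Sieve

end
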